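import Summits.QuantumFields.YangMills.Theorems.BalabanLadderIROddTorusChessboardDir0
import HarnessLib

/-!
# The chessboard estimate for exponential plaquette observables on the ODD torus

Support file (seat ym-infvol-p3, fleet R136 (i); bears on crux `IR` = stmt-QuantumFields-19354, registered line
«af-pincer-T» clause (iii_T) of `TypShellCond` / line «hamming» clause (ii); count-neutral helper).

MAIN RESULT (`wilsonExpectation_expObs_le_rpow_orient`, `wilsonExpectation_expObs_le_exp_card`).  Wilson lattice gauge
theory of a compact group `G` with a continuous matrix representation `ρ` on the torus `(ℤ/Lℤ)^d`, `L` ODD, `L ≥ 3`,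
coupling `β`, and `0 ≤ c ≤ β`.  For every finite set `P` of plaquettes of ONE orientation `o`,

  `⟨exp(c ∑_{q ∈ P} φ_q)⟩_{Λ,β} ≤ ⟨exp(c ∑_{q of orientation o} φ_q)⟩_{Λ,β} ^ (#P / L^d)`
  `                       ≤ exp( (#P / L^d) · (log Z_Λ(β - c) - log Z_Λ(β)) )`,

`φ_q = N - Re tr ρ(U_q)`.  The exponent is `#P` times the free-energy-density difference `f_Λ(β-c) - f_Λ(β)`, so the
bound is UNIFORM IN THE VOLUME once `f_Λ` is (tree: `WeakCouplingRates.su2_torusLogPartition_lower` for `SU(2)`).  This is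
the Fröhlich–Israel–Lieb–Simon chessboard estimate on the odd tori `(ℤ/(2S+1))^d` of the summit statement — the tree's
`SoloBlind.wilsonExpectation_exp_plaquetteCost_le` is the case `#P = 1` with the weaker exponent `(4/L)^d`.

Proof: the abstract odd-side chessboard estimate `Literature.Probability.LatticeModels.chessboard_le_rpow_odd` applied to
`ψ_o(A) = ⟨exp(c ∑_{x∈A} φ_{toPlaq o x})⟩` (`…OddTorusChessboardRows`): non-negativity, `ψ_o(∅) = 1`, `ψ_o(univ) ≥ 1`,
translation invariance, and the reflection Cauchy–Schwarz inequality in every axis — in the axis `0` by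
`psi_sq_le_zero` (`…OddTorusChessboardDir0`: weighted reflection positivity with Chebyshev weights on the cut row for
in-plane orientations / on the shared row for transverse ones), in the axis `k` by conjugation with the axis exchange
`0 ↔ k` (`psi_swap`, `image_swapIdx_csymP`, `image_swapIdx_symM`).

HONEST FRAMING: a finite-torus large-field RARITY tool (Peierls–chessboard), volume-uniform; nothing here is a
statement about decoupling, the mass gap, or infinite volume.  References: Fröhlich–Israel–Lieb–Simon, CMP 62 (1978)
Thm. 4.1; Osterwalder–Seiler, Ann. Phys. 110 (1978) §2; Seiler LNP 159 Ch. 4.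
-/

noncomputable section

open MeasureTheory Finset
open Literature.MathematicalPhysics.QuantumFieldTheory Literature.MathematicalPhysics.QuantumLattice
open Literature.MathematicalPhysics.QuantumFieldTheory.WilsonRP
open Literature.MathematicalPhysics.QuantumFieldTheory.WilsonOddRP
open Literature.Barriers.CriticalPhenomena.NonGibbs
open Literature.Probability.LatticeModels
open Summit.QuantumFields.YangMills.Theorems.SoloBlind

namespace Summit.QuantumFields.YangMills.Theorems.OddTorusChessboard

variable {d L N : ℕ} [NeZero d] [NeZero L] {G : Type*} [Group G] [TopologicalSpace G]
  [IsTopologicalGroup G] [CompactSpace G] [MeasurableSpace G] [BorelSpace G]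
  (ρ : G →* Matrix (Fin N) (Fin N) ℂ)

/-! ### §1. The reflection Cauchy–Schwarz inequality in every axis -/

/-- **Schwarz inequality of `ψ_o` in the axis `k`**, by conjugating the axis-`0` inequality of the exchanged
orientation `oSwap k o` with the axis exchange `0 ↔ k`. -/
theorem psi_sq_le (hL : Odd L) (hL3 : 3 ≤ L) (hρ : Continuous ρ) {β c : ℝ} (hc : 0 ≤ c) (hcβ : c ≤ β)
    (o : Orient d) (k : Fin d) (A : Finset (BlockIdx d L)) :
    psi (G := G) ρ β c o A ^ 2 ≤ psi ρ β c o (csymP k A) * psi ρ β c o (symM k 1 A) := by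
  haveI : Fact (1 < L) := ⟨by omega⟩
  have h := psi_sq_le_zero ρ hL hL3 hρ hc hcβ (oSwap (L := L) k o) (A.image (swapIdx k))
  rwa [← image_swapIdx_csymP, ← image_swapIdx_symM, psi_swap ρ hρ, psi_swap ρ hρ, psi_swap ρ hρ] at h

/-! ### §2. The chessboard estimate for `ψ_o` -/

/-- **`ψ_o(A) ≤ ψ_o(univ) ^ (#A / L^d)`** — the abstract odd-side chessboard estimate applied to `ψ_o`. -/
theorem psi_le_rpow (hL : Odd L) (hL3 : 3 ≤ L) (hρ : Continuous ρ) {β c : ℝ} (hc : 0 ≤ c) (hcβ : c ≤ β)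
    (o : Orient d) (A : Finset (BlockIdx d L)) :
    psi (G := G) ρ β c o A ≤ psi ρ β c o (univ : Finset (BlockIdx d L)) ^ ((#A : ℝ) / (L : ℝ) ^ d) :=
  chessboard_le_rpow_odd hL hL3 (ψ := psi ρ β c o) (fun A => psi_nonneg ρ β c o A)
    (le_of_eq (psi_empty ρ hρ β c o)) (lt_of_lt_of_le one_pos (one_le_psi ρ hρ β hc o _))
    (fun i a A => psi_translate ρ β c o i a A) (fun i A => psi_sq_le ρ hL hL3 hρ hc hcβ o i A) A

/-! ### §3. Back to plaquettes -/

omit [NeZero d] in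
/-- All blocks label all plaquettes of the orientation. -/
theorem image_toPlaq_univ (o : Orient d) :
    (univ : Finset (BlockIdx d L)).image (toPlaq o) = univ.filter fun q : Plaquette d L => q.2 = o := by
  ext q
  simp only [Finset.mem_image, Finset.mem_univ, true_and, Finset.mem_filter]
  constructor
  · rintro ⟨c, rfl⟩; rfl
  · intro hq; exact ⟨_, toPlaq_surj o hq⟩

omit [NeZero d] [NeZero L] in
/-- A set of plaquettes of orientation `o` is the image of a pattern of the same cardinality. -/
theorem exists_image_toPlaq_eq (o : Orient d) (P : Finset (Plaquette d L)) (hP : ∀ q ∈ P, q.2 = o) :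
    ∃ A : Finset (BlockIdx d L), A.image (toPlaq o) = P ∧ #A = #P := by
  classical
  refine ⟨P.image fun q => fun k => q.1 k + rowShift L o k, ?_, ?_⟩
  · rw [Finset.image_image]
    ext q
    simp only [Finset.mem_image, Function.comp_apply]
    constructor
    · rintro ⟨q', hq', rfl⟩
      rw [toPlaq_surj o (hP q' hq')]; exact hq'
    · intro hq
      exact ⟨q, hq, toPlaq_surj o (hP q hq)⟩
  · refine Finset.card_image_of_injOn fun q hq q' hq' h => ?_
    have h1 : q.1 = q'.1 := by
      funext k
      have := congrFun h k
      simpa using this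
    exact Prod.ext h1 (by rw [hP q (Finset.mem_coe.1 hq), hP q' (Finset.mem_coe.1 hq')])

/-- **The chessboard estimate on the odd torus, one orientation**: for `L` odd, `L ≥ 3`, continuous `ρ`, `0 ≤ c ≤ β`
and a finite set `P` of plaquettes of orientation `o`,
`⟨exp(c ∑_{q∈P} φ_q)⟩_{Λ,β} ≤ ⟨exp(c ∑_{q of orientation o} φ_q)⟩_{Λ,β} ^ (#P / L^d)`. -/
theorem wilsonExpectation_expObs_le_rpow_orient (hL : Odd L) (hL3 : 3 ≤ L) (hρ : Continuous ρ) {β c : ℝ}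
    (hc : 0 ≤ c) (hcβ : c ≤ β) (o : Orient d) (P : Finset (Plaquette d L)) (hP : ∀ q ∈ P, q.2 = o) :
    wilsonExpectation ρ β (expObs (G := G) ρ c P) ≤
      wilsonExpectation ρ β (expObs (G := G) ρ c (univ.filter fun q : Plaquette d L => q.2 = o)) ^
        ((#P : ℝ) / (L : ℝ) ^ d) := by
  obtain ⟨A, hA, hcard⟩ := exists_image_toPlaq_eq o P hP
  have h := psi_le_rpow ρ hL hL3 hρ hc hcβ o A
  rw [psi, psi, hA, image_toPlaq_univ, hcard] at h
  exact h

/-- **Free-energy form**: `⟨exp(c ∑_{q∈P} φ_q)⟩_{Λ,β} ≤ exp( (#P / L^d) · (log Z_Λ(β-c) - log Z_Λ(β)) )` for plaquettes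
of one orientation — `#P` times the finite-volume free-energy-density difference. -/
theorem wilsonExpectation_expObs_le_exp_card (hL : Odd L) (hL3 : 3 ≤ L) (hρ : Continuous ρ) {β c : ℝ}
    (hc : 0 ≤ c) (hcβ : c ≤ β) (o : Orient d) (P : Finset (Plaquette d L)) (hP : ∀ q ∈ P, q.2 = o) :
    wilsonExpectation ρ β (expObs (G := G) ρ c P) ≤
      Real.exp ((#P : ℝ) / (L : ℝ) ^ d * (torusLogPartition d ρ (β - c) L - torusLogPartition d ρ β L)) := by
  have hρN : ∀ g : G, (ρ g).trace.re ≤ N := fun g => by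
    have h := Literature.RepresentationTheory.CompactGroups.CompactGroup.abs_re_trace_le_card ρ hρ g
    simp only [Fintype.card_fin] at h
    exact (le_abs_self _).trans h
  have h1 := wilsonExpectation_expObs_le_rpow_orient ρ hL hL3 hρ hc hcβ o P hP
  have h2 := wilsonExpectation_expObs_le_exp (d := d) (L := L) (G := G) ρ hρ hρN hc β
    (univ.filter fun q : Plaquette d L => q.2 = o)
  have hr : (0 : ℝ) ≤ (#P : ℝ) / (L : ℝ) ^ d := by positivity
  calc wilsonExpectation ρ β (expObs (G := G) ρ c P)
      ≤ wilsonExpectation ρ β (expObs (G := G) ρ c (univ.filter fun q : Plaquette d L => q.2 = o)) ^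
          ((#P : ℝ) / (L : ℝ) ^ d) := h1
    _ ≤ Real.exp (torusLogPartition d ρ (β - c) L - torusLogPartition d ρ β L) ^ ((#P : ℝ) / (L : ℝ) ^ d) :=
        Real.rpow_le_rpow (wilsonExpectation_expObs_nonneg ρ β c _) h2 hr
    _ = Real.exp ((#P : ℝ) / (L : ℝ) ^ d * (torusLogPartition d ρ (β - c) L - torusLogPartition d ρ β L)) := by
        rw [← Real.exp_mul, mul_comm]

end Summit.QuantumFields.YangMills.Theorems.OddTorusChessboard

end
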